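import Summits.ResolutionOfSingularities.ResolutionOfSingularities.Theorems.EquisingularLiftEquisingularLiftNatResidueHypDefsE5
import HarnessLib

/-!
# [OURS · L1 W4.5(b) · EL♮ / EL♮(3)] RESIDUE HYPOTHESIS DEFS E6 — WIDTH TABLE D12 «NOSE CREASE / SECTION ROUND» (DRAFT, NOT DEALT): the tail rule
# `TowerSecRoundSigma`, the Σ-doors `ReachDirectPlanarNoseSigma₂` / `ReachDirectCINoseSigma₂` and the blob `NoseHypHostedNestEquinodalDirectCISigmaBTriplePrime₂`

Draft typed by res-type-027 g23 ahead of the desk's deal (booking 2026-08-29T07:35:35Z, F4: panel certification of lead-1's CREASE7 customer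
`S_cr(G₇) = V(g₇² + w⁴B) ⊂ ℙ³/𝔽̄₇` FIRST; sizing idea-2 g30 08:16:22Z (a)–(d) + idea-3 g16 `D12-SIZING-idea3.md`).  WHAT.  (1) `TowerSecRoundSigma` — the
section-round TAIL rule, letters = the tail transcription of ✓ P9's (HR-SEC) (…Defs11): (L1) `Z ⊆ E ∩ T`, `Z.Nonempty`, `¬ T ⊆ Z`, (N1), (L2) closed-point
form, (L3) `DirStepUnobs`, (N3) curve clause, blow-up of `Z`, branch-1 transports of ✓ `TowerRoundBTriplePrime`.  (2) `ReachDirectPlanarNoseSigma₂` /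
`ReachDirectCINoseSigma₂` = ✓ `ReachDirectPlanarNose₂` (…DefsE4 :48–:95) / ✓ `ReachDirectCINose₂` (…DefsE5 :42–:77) VERBATIM with ONE added rule hypothesis
`TowerSecRoundSigma ℙ F₃ υ' Z hZ R →` in the inline `∀R`-tail after `TowerRoundBTriplePrime … R →` (placement = idea-2 (b) / idea-3 ACK: the live tail after the
direct round).  (3) the blob `NoseHypHostedNestEquinodalDirectCISigmaBTriplePrime₂` = ✓ the 47th's blob `NoseHypHostedNestEquinodalDirectCIBTriplePrime₂` (…DefsE5)
VERBATIM with the two direct doors replaced by their Σ-variants (rule door `(ν4 ∨ ν3ᵈΣ) ∨ ν3ᶜⁱΣ`).  (4) pure logic: more closure asked of `R` ⇒ old door ⇒ Σ-door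
(`reachDirectPlanarNoseSigma₂_of_direct₂`, `reachDirectCINoseSigma₂_of_directCI₂`), 47th blob ⇒ Σ-blob (`…Sigma…₂_of_directCI₂`), and the contrapositives the
REPLACE cut «¬((ν4 ∨ ν3ᵈ) ∨ ν3ᶜⁱ) ↦ ¬((ν4 ∨ ν3ᵈΣ) ∨ ν3ᶜⁱΣ)» consumes (`not_noseHypHostedNestEquinodalDirectCIBTriplePrime₂_of_not_directCISigma₂` and the chain down
to `NoseHypPointsFirstBTriplePrime`).  OURS; NOT statements of any manuscript ([Hironaka2017] a candidate only); AI-written, weaker than expert review; no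
`sorry`, no instance, no notation; `--kind definition --supports stmt-ResolutionOfSingularities-20148 --as helper` WHEN DEALT.
-/

set_option linter.dupNamespace false
noncomputable section
open CategoryTheory CategoryTheory.Limits AlgebraicGeometry TopologicalSpace Topology IsLocalRing
open Literature.AlgebraicGeometry.Resolution
open AlgebraicGeometry.Scheme.IdealSheafData
namespace Summit.ResolutionOfSingularities.ResolutionOfSingularities.Cruxes.EquisingularLiftNat.Sections

/-- **`TowerSecRoundSigma F₉ F₁₀ υ' Z₉ hZ₉ R`** — the «SECTION ROUND» tail rule (WIDTH TABLE D12 «NOSE CREASE / SECTION ROUND», desk BOOKING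
2026-08-29T07:35:35Z; letters = idea-2 g30 / idea-3 g16 D12 SIZING 08:16–08:17Z (a)(d): the EXACT tail transcription of ✓ `PrefixReachKeyLetterParam9`'s prefix
clause (HR-SEC), …Defs11 :195–:212, host = the tail's distinguished letter `E`).  From a reached tail position `R G γ T E Es Ns K`, a closed `Z` with
(L1) `Z ⊆ E ∩ T`, `Z.Nonempty`, `¬ T ⊆ Z`; (N1) finitely many non-regular points of `Z̃`; (L2) at every CLOSED point `g ∈ Z` the ideal of `Z` is the
ideal of `E` plus ONE element `f ∉ 𝓘(E)_g + 𝔪_g²` (stalk currency); (L3) `DirStepUnobs G E hE Z hZ`; (N3) `Z̃` one-dimensional at its closed points; then the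
blow-up `υ₂` of `Z`, `E' = υ₂⁻¹ Z ∨ E' = St E`, the `K'`-clause and the member / non-member transports of ✓ `TowerRoundBTriplePrime`'s branch 1 VERBATIM.  No
regularity of the host or of the ambient is read (specimen: CREASE7's crease `C′ ⊂ E_Z` through the seven deep points; Q47₂'s section `Γ′ ⊂ E_Z` at `Q_P`).
The parameters `F₉ F₁₀ υ' Z₉ hZ₉` are kept only for uniformity with the other tail rules (the body does not read them).  Upstairs supplier (not here): nose-w1's
✓ `…NatSecCurveCartier` (p708682) + `…NatSecCurveLift` cores at the invariant's model of `E`. [OURS · named hypothesis fragment, no mathematical content of its own] -/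
def TowerSecRoundSigma (F₉ F₁₀ : Scheme.{0}) (_υ' : F₁₀ ⟶ F₉) (Z₉ : Set F₉) (_hZ₉ : IsClosed Z₉)
    (R : ∀ G : Scheme.{0}, (G ⟶ F₁₀) → Set G → Set G → List (Set G) → List (Set G) → Set G → Prop) : Prop :=
  ∀ (G G' : Scheme.{0}) (γ : G ⟶ F₁₀) (T E : Set G) (Es Ns : List (Set G)) (K : Set G) (hE : IsClosed E) (Z : Set G) (hZ : IsClosed Z)
      (υ₂ : G' ⟶ G) (K' : Set G') (E' : Set G') (Es' Ns' : List (Set G')),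
    R G γ T E Es Ns K →
    -- (L1)
    Z ⊆ E ∩ T → Z.Nonempty → ¬ T ⊆ Z →
    -- (N1) finitely many non-regular points of `Z̃`
    Set.Finite {z : ↥(redSub G Z hZ) | ¬ IsRegularLocalRing ((redSub G Z hZ).presheaf.stalk z)} →
    -- (L2) `Z̃` is cut on `Ẽ`, at every closed point, by ONE element outside `𝓘(E) + 𝔪²`
    (∀ g ∈ Z, IsClosed ({g} : Set G) → ∃ f : G.presheaf.stalk g,
      stalkIdeal (vanishingIdeal (⟨Z, hZ⟩ : Closeds G)) g = stalkIdeal (vanishingIdeal (⟨E, hE⟩ : Closeds G)) g ⊔ Ideal.span {f} ∧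
        f ∉ stalkIdeal (vanishingIdeal (⟨E, hE⟩ : Closeds G)) g ⊔ (maximalIdeal (G.presheaf.stalk g)) ^ 2) →
    -- (L3) unobstructed in the host
    DirStepUnobs G E hE Z hZ →
    -- (N3) curve clause
    (∀ z : ↥(redSub G Z hZ), IsClosed ({z} : Set ↥(redSub G Z hZ)) → ringKrullDim ((redSub G Z hZ).presheaf.stalk z) = ((1 : ℕ) : WithBot ℕ∞)) →
    IsBlowup υ₂ (vanishingIdeal (⟨Z, hZ⟩ : Closeds G)) →
    (E' = υ₂ ⁻¹' Z ∨ E' = closure (υ₂ ⁻¹' (E \ Z))) →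
    (K' = ∅ ∨ ((ConeWitness G E hE K Z hZ ∨ closure (Z \ closure K) = Z) ∧ K' = closure (υ₂ ⁻¹' (K \ Z)))) →
    (∀ F' ∈ Es', ∃ F ∈ E :: Es, RoundTransportOKDoublePrime υ₂ Z hZ E E F F') →
    (∀ F' ∈ Ns', ∃ F ∈ (E :: Es) ++ Ns, F' = closure (υ₂ ⁻¹' (F \ Z))) →
    R G' (υ₂ ≫ γ) (closure (υ₂ ⁻¹' (T \ Z))) E' Es' Ns' K'

/-- **`ReachDirectPlanarNoseSigma₂`** — ✓ `ReachDirectPlanarNose₂` (…DefsE4) VERBATIM with ONE added rule hypothesis `TowerSecRoundSigma ℙ F₃ υ' Z hZ R →` in the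
inline `∀R`-tail (the tail motive is ALSO asked to be closed under the section round; D12). [OURS · named hypothesis fragment, no mathematical content of its own] -/
def ReachDirectPlanarNoseSigma₂ (k : Type) [Field k] (n : ℕ) (ℓ : MvPolynomial (Fin (n + 1)) k)
    (T₁ : Set (Literature.AlgebraicGeometry.Motives.projectiveSpace n k).left) (F₉ : Scheme.{0}) (β : F₉ ⟶ (Literature.AlgebraicGeometry.Motives.projectiveSpace n k).left) (T₉ E₉ : Set F₉) : Prop :=
  letI := MvPolynomial.gradedAlgebra (σ := Fin (n + 1)) (R := k)
  E₉ = ∅ ∧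
  ∃ (Z : Set (Literature.AlgebraicGeometry.Motives.projectiveSpace n k).left) (hZ : IsClosed Z),
    Z ⊆ T₁ ∧ ¬ (T₁ ⊆ Z) ∧ Z.Infinite ∧
    Z ⊆ {y : (Literature.AlgebraicGeometry.Motives.projectiveSpace n k).left | ℓ ∈ (y : ProjectiveSpectrum (MvPolynomial.homogeneousSubmodule (Fin (n + 1)) k)).asHomogeneousIdeal} ∧
    IsPreirreducible Z ∧
    -- curve clause
    (∀ z : ↥(redSub (Literature.AlgebraicGeometry.Motives.projectiveSpace n k).left Z hZ), IsClosed ({z} : Set ↥(redSub (Literature.AlgebraicGeometry.Motives.projectiveSpace n k).left Z hZ)) →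
      ringKrullDim ((redSub (Literature.AlgebraicGeometry.Motives.projectiveSpace n k).left Z hZ).presheaf.stalk z) = ((1 : ℕ) : WithBot ℕ∞)) ∧
    -- ambient regular along `Z̃`
    (∀ (i : redSub (Literature.AlgebraicGeometry.Motives.projectiveSpace n k).left Z hZ ⟶ redSub (Literature.AlgebraicGeometry.Motives.projectiveSpace n k).left Set.univ isClosed_univ), i ≫ redSubι (Literature.AlgebraicGeometry.Motives.projectiveSpace n k).left Set.univ isClosed_univ = redSubι (Literature.AlgebraicGeometry.Motives.projectiveSpace n k).left Z hZ →
      ∀ z : ↥(redSub (Literature.AlgebraicGeometry.Motives.projectiveSpace n k).left Z hZ), IsRegularLocalRing ((redSub (Literature.AlgebraicGeometry.Motives.projectiveSpace n k).left Set.univ isClosed_univ).presheaf.stalk (i.base z))) ∧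
    -- host regular along `Z̃`
    (∀ (i : redSub (Literature.AlgebraicGeometry.Motives.projectiveSpace n k).left Z hZ ⟶ redSub (Literature.AlgebraicGeometry.Motives.projectiveSpace n k).left (closure {y : (Literature.AlgebraicGeometry.Motives.projectiveSpace n k).left | ℓ ∈ (y : ProjectiveSpectrum (MvPolynomial.homogeneousSubmodule (Fin (n + 1)) k)).asHomogeneousIdeal}) isClosed_closure),
      i ≫ redSubι (Literature.AlgebraicGeometry.Motives.projectiveSpace n k).left (closure {y : (Literature.AlgebraicGeometry.Motives.projectiveSpace n k).left | ℓ ∈ (y : ProjectiveSpectrum (MvPolynomial.homogeneousSubmodule (Fin (n + 1)) k)).asHomogeneousIdeal}) isClosed_closure = redSubι (Literature.AlgebraicGeometry.Motives.projectiveSpace n k).left Z hZ →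
      ∀ z : ↥(redSub (Literature.AlgebraicGeometry.Motives.projectiveSpace n k).left Z hZ), IsRegularLocalRing ((redSub (Literature.AlgebraicGeometry.Motives.projectiveSpace n k).left (closure {y : (Literature.AlgebraicGeometry.Motives.projectiveSpace n k).left | ℓ ∈ (y : ProjectiveSpectrum (MvPolynomial.homogeneousSubmodule (Fin (n + 1)) k)).asHomogeneousIdeal}) isClosed_closure).presheaf.stalk (i.base z))) ∧
    -- host two-dimensional along `Z` (n = 3 in effect)
    (∀ e : ↥(redSub (Literature.AlgebraicGeometry.Motives.projectiveSpace n k).left (closure {y : (Literature.AlgebraicGeometry.Motives.projectiveSpace n k).left | ℓ ∈ (y : ProjectiveSpectrum (MvPolynomial.homogeneousSubmodule (Fin (n + 1)) k)).asHomogeneousIdeal}) isClosed_closure),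
      IsClosed ({e} : Set ↥(redSub (Literature.AlgebraicGeometry.Motives.projectiveSpace n k).left (closure {y : (Literature.AlgebraicGeometry.Motives.projectiveSpace n k).left | ℓ ∈ (y : ProjectiveSpectrum (MvPolynomial.homogeneousSubmodule (Fin (n + 1)) k)).asHomogeneousIdeal}) isClosed_closure)) →
      (redSubι (Literature.AlgebraicGeometry.Motives.projectiveSpace n k).left (closure {y : (Literature.AlgebraicGeometry.Motives.projectiveSpace n k).left | ℓ ∈ (y : ProjectiveSpectrum (MvPolynomial.homogeneousSubmodule (Fin (n + 1)) k)).asHomogeneousIdeal}) isClosed_closure e : (Literature.AlgebraicGeometry.Motives.projectiveSpace n k).left) ∈ Z →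
      ringKrullDim ((redSub (Literature.AlgebraicGeometry.Motives.projectiveSpace n k).left (closure {y : (Literature.AlgebraicGeometry.Motives.projectiveSpace n k).left | ℓ ∈ (y : ProjectiveSpectrum (MvPolynomial.homogeneousSubmodule (Fin (n + 1)) k)).asHomogeneousIdeal}) isClosed_closure).presheaf.stalk e) = ((2 : ℕ) : WithBot ℕ∞)) ∧
    -- (N1) finitely many non-regular points of the reduced nose `Z̃` (requested binder; = stub-2's SIG binder verbatim)
    Set.Finite {z : ↥(redSub (Literature.AlgebraicGeometry.Motives.projectiveSpace n k).left Z hZ) |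
      ¬ IsRegularLocalRing ((redSub (Literature.AlgebraicGeometry.Motives.projectiveSpace n k).left Z hZ).presheaf.stalk z)} ∧
    -- the EQUATION block (= `EqCertAt₀`'s clauses 1–4: hyperplane coordinates `B` and ONE squarefree form `g` cutting out `Z` on `V₊(ℓ)`)
    (∃ (e : ℕ) (g : MvPolynomial (Fin (n + 1)) k) (B : Fin (n + 1) → Fin n → k) (r : Fin n → Fin (n + 1)),
      g.IsHomogeneous e ∧ Squarefree (restrictToHyperplane B g) ∧
      Z = {y : (Literature.AlgebraicGeometry.Motives.projectiveSpace n k).left | ℓ ∈ (y : ProjectiveSpectrum (MvPolynomial.homogeneousSubmodule (Fin (n + 1)) k)).asHomogeneousIdeal ∧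
             g ∈ (y : ProjectiveSpectrum (MvPolynomial.homogeneousSubmodule (Fin (n + 1)) k)).asHomogeneousIdeal} ∧
      restrictToHyperplane B ℓ = 0 ∧ Function.Injective r ∧ (Matrix.of fun j j' : Fin n => B (r j) j').det ≠ 0) ∧
    -- the DIRECT nose round at `Z` itself (no inner motive, no reached-stage clauses), then a B‴ tail
    ∃ (F₃ : Scheme.{0}) (υ' : F₃ ⟶ (Literature.AlgebraicGeometry.Motives.projectiveSpace n k).left),
      IsBlowup υ' (vanishingIdeal (⟨Z, hZ⟩ : Closeds (Literature.AlgebraicGeometry.Motives.projectiveSpace n k).left)) ∧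
      ∃ (γ' : F₉ ⟶ F₃) (E' : Set F₉) (Es' Ns' : List (Set F₉)) (K' : Set F₉),
        (∀ R : (∀ G : Scheme.{0}, (G ⟶ F₃) → Set G → Set G → List (Set G) → List (Set G) → Set G → Prop),
          R F₃ (𝟙 F₃) (closure (υ' ⁻¹' (T₁ \ Z))) (υ' ⁻¹' Z) [] [] ∅ →
          TowerPtRegB₄ F₃ R → TowerPtRamB₄ F₃ R → TowerRoundBTriplePrime (Literature.AlgebraicGeometry.Motives.projectiveSpace n k).left F₃ υ' Z hZ R →
          TowerSecRoundSigma (Literature.AlgebraicGeometry.Motives.projectiveSpace n k).left F₃ υ' Z hZ R →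
          R F₉ γ' T₉ E' Es' Ns' K') ∧
        β = γ' ≫ υ'

/-- **`ReachDirectCINoseSigma₂`** — ✓ `ReachDirectCINose₂` (…DefsE5) VERBATIM with ONE added rule hypothesis `TowerSecRoundSigma ℙ F₃ υ' Z hZ R →` in the inline
`∀R`-tail (D12). [OURS · named hypothesis fragment, no mathematical content of its own] -/
def ReachDirectCINoseSigma₂ (k : Type) [Field k] (n : ℕ)
    (T₁ : Set (Literature.AlgebraicGeometry.Motives.projectiveSpace n k).left) (F₉ : Scheme.{0}) (β : F₉ ⟶ (Literature.AlgebraicGeometry.Motives.projectiveSpace n k).left) (T₉ E₉ : Set F₉) : Prop :=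
  letI := MvPolynomial.gradedAlgebra (σ := Fin (n + 1)) (R := k)
  E₉ = ∅ ∧
  ∃ (Z : Set (Literature.AlgebraicGeometry.Motives.projectiveSpace n k).left) (hZ : IsClosed Z),
    Z ⊆ T₁ ∧ ¬ (T₁ ⊆ Z) ∧ Z.Infinite ∧
    -- curve clause (= the n-SCOPE guard: fires only for n = 3)
    (∀ z : ↥(redSub (Literature.AlgebraicGeometry.Motives.projectiveSpace n k).left Z hZ), IsClosed ({z} : Set ↥(redSub (Literature.AlgebraicGeometry.Motives.projectiveSpace n k).left Z hZ)) →
      ringKrullDim ((redSub (Literature.AlgebraicGeometry.Motives.projectiveSpace n k).left Z hZ).presheaf.stalk z) = ((1 : ℕ) : WithBot ℕ∞)) ∧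
    -- (N1) finitely many non-regular points of the reduced nose `Z̃` (= the supply lemma's binder)
    Set.Finite {z : ↥(redSub (Literature.AlgebraicGeometry.Motives.projectiveSpace n k).left Z hZ) |
      ¬ IsRegularLocalRing ((redSub (Literature.AlgebraicGeometry.Motives.projectiveSpace n k).left Z hZ).presheaf.stalk z)} ∧
    -- the COMPLETE-INTERSECTION block (= ✓ `CIModel.ci_trace_and_flat`'s hypotheses read downstairs) + (HOST-J)
    (∃ (d₁ d₂ : ℕ) (f₁ f₂ : MvPolynomial (Fin (n + 1)) k),
      f₁.IsHomogeneous d₁ ∧ f₂.IsHomogeneous d₂ ∧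
      Z = {y : (Literature.AlgebraicGeometry.Motives.projectiveSpace n k).left | f₁ ∈ (y : ProjectiveSpectrum (MvPolynomial.homogeneousSubmodule (Fin (n + 1)) k)).asHomogeneousIdeal ∧
             f₂ ∈ (y : ProjectiveSpectrum (MvPolynomial.homogeneousSubmodule (Fin (n + 1)) k)).asHomogeneousIdeal} ∧
      IsRelPrime f₁ f₂ ∧ f₂ ≠ 0 ∧ (Ideal.span {f₁, f₂}).IsRadical ∧
      -- (HOST-J): the hypersurface `V₊(f₁)` is smooth at every point of `Z`
      (∀ y ∈ Z, ∃ i : Fin (n + 1), ¬ (MvPolynomial.pderiv i f₁ ∈ (y : ProjectiveSpectrum (MvPolynomial.homogeneousSubmodule (Fin (n + 1)) k)).asHomogeneousIdeal))) ∧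
    -- the DIRECT nose round at `Z` itself, then a B‴ tail (verbatim)
    ∃ (F₃ : Scheme.{0}) (υ' : F₃ ⟶ (Literature.AlgebraicGeometry.Motives.projectiveSpace n k).left),
      IsBlowup υ' (vanishingIdeal (⟨Z, hZ⟩ : Closeds (Literature.AlgebraicGeometry.Motives.projectiveSpace n k).left)) ∧
      ∃ (γ' : F₉ ⟶ F₃) (E' : Set F₉) (Es' Ns' : List (Set F₉)) (K' : Set F₉),
        (∀ R : (∀ G : Scheme.{0}, (G ⟶ F₃) → Set G → Set G → List (Set G) → List (Set G) → Set G → Prop),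
          R F₃ (𝟙 F₃) (closure (υ' ⁻¹' (T₁ \ Z))) (υ' ⁻¹' Z) [] [] ∅ →
          TowerPtRegB₄ F₃ R → TowerPtRamB₄ F₃ R → TowerRoundBTriplePrime (Literature.AlgebraicGeometry.Motives.projectiveSpace n k).left F₃ υ' Z hZ R →
          TowerSecRoundSigma (Literature.AlgebraicGeometry.Motives.projectiveSpace n k).left F₃ υ' Z hZ R →
          R F₉ γ' T₉ E' Es' Ns' K') ∧
        β = γ' ≫ υ'

/-- **`NoseHypHostedNestEquinodalDirectCISigmaBTriplePrime₂ k n H ι`** (D12 blob, rule door «(ν4 ∨ ν3ᵈΣ) ∨ ν3ᶜⁱΣ») — ✓ `NoseHypHostedNestEquinodalDirectCIBTriplePrime₂`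
(…DefsE5, the 47th's blob) VERBATIM except that the two direct doors are their Σ-variants `ReachDirectPlanarNoseSigma₂` / `ReachDirectCINoseSigma₂`.  More closure
asked of `Q`'s tails ⇒ implied by the 47th's blob (`…_of_directCI₂` below, pure logic); REPLACE shape «¬ (47th blob) ↦ ¬ (this blob)».
[OURS · L1 W4.5b · named hypothesis, no mathematical content of its own] -/
def NoseHypHostedNestEquinodalDirectCISigmaBTriplePrime₂ (k : Type) [Field k] [IsAlgClosed k] (n : ℕ) (H : AlgebraicGeometry.Scheme.{0})
    (ι : H ⟶ (Literature.AlgebraicGeometry.Motives.projectiveSpace n k).left) : Prop :=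
  letI := MvPolynomial.gradedAlgebra (σ := Fin (n + 1)) (R := k)
  ∃ (E₀ : Set (Literature.AlgebraicGeometry.Motives.projectiveSpace n k).left),
    (E₀ = ∅ ∨ ∃ ℓ : MvPolynomial (Fin (n + 1)) k, ℓ.IsHomogeneous 1 ∧ ℓ ≠ 0 ∧
      ¬ (Set.range ι ⊆ {y : (Literature.AlgebraicGeometry.Motives.projectiveSpace n k).left |
        ℓ ∈ (y : ProjectiveSpectrum (MvPolynomial.homogeneousSubmodule (Fin (n + 1)) k)).asHomogeneousIdeal}) ∧
      E₀ = {y : (Literature.AlgebraicGeometry.Motives.projectiveSpace n k).left |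
        ℓ ∈ (y : ProjectiveSpectrum (MvPolynomial.homogeneousSubmodule (Fin (n + 1)) k)).asHomogeneousIdeal}) ∧
    (∃ (F' : AlgebraicGeometry.Scheme.{0}) (ρ' : F' ⟶ (Literature.AlgebraicGeometry.Motives.projectiveSpace n k).left) (T' : Set F'),
      (∀ Q : (∀ F₁ : AlgebraicGeometry.Scheme.{0}, (F₁ ⟶ (Literature.AlgebraicGeometry.Motives.projectiveSpace n k).left) → Set F₁ → Set F₁ → Prop),
        Q (Literature.AlgebraicGeometry.Motives.projectiveSpace n k).left (𝟙 (Literature.AlgebraicGeometry.Motives.projectiveSpace n k).left) (Set.range ι) E₀ →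
        (∀ (F₁ F₂ : AlgebraicGeometry.Scheme.{0}) (ρ : F₁ ⟶ (Literature.AlgebraicGeometry.Motives.projectiveSpace n k).left) (T₁ E₁ : Set F₁)
            (x : ↥((AlgebraicGeometry.Scheme.IdealSheafData.vanishingIdeal (⟨closure T₁, isClosed_closure⟩ : TopologicalSpace.Closeds F₁))).subscheme) (υ : F₂ ⟶ F₁) (hx : IsClosed ({(((AlgebraicGeometry.Scheme.IdealSheafData.vanishingIdeal (⟨closure T₁, isClosed_closure⟩ : TopologicalSpace.Closeds F₁))).subschemeι x : F₁)} : Set F₁)),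
          Q F₁ ρ T₁ E₁ → ¬ IsRegularLocalRing (((AlgebraicGeometry.Scheme.IdealSheafData.vanishingIdeal (⟨closure T₁, isClosed_closure⟩ : TopologicalSpace.Closeds F₁))).subscheme.presheaf.stalk x) →
          IsRegularLocalRing (F₁.presheaf.stalk (((AlgebraicGeometry.Scheme.IdealSheafData.vanishingIdeal (⟨closure T₁, isClosed_closure⟩ : TopologicalSpace.Closeds F₁))).subschemeι x : F₁)) →
          ((((AlgebraicGeometry.Scheme.IdealSheafData.vanishingIdeal (⟨closure T₁, isClosed_closure⟩ : TopologicalSpace.Closeds F₁))).subschemeι x : F₁) ∈ closure E₁ → ∀ e : ↥(redSub F₁ (closure E₁) isClosed_closure), (redSubι F₁ (closure E₁) isClosed_closure e : F₁) = (((AlgebraicGeometry.Scheme.IdealSheafData.vanishingIdeal (⟨closure T₁, isClosed_closure⟩ : TopologicalSpace.Closeds F₁))).subschemeι x : F₁) →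
          IsRegularLocalRing ((redSub F₁ (closure E₁) isClosed_closure).presheaf.stalk e)) → Literature.AlgebraicGeometry.Resolution.IsBlowup υ
            (AlgebraicGeometry.Scheme.IdealSheafData.vanishingIdeal (⟨{(((AlgebraicGeometry.Scheme.IdealSheafData.vanishingIdeal (⟨closure T₁, isClosed_closure⟩ : TopologicalSpace.Closeds F₁))).subschemeι x : F₁)}, hx⟩ : TopologicalSpace.Closeds F₁)) →
          Q F₂ (υ ≫ ρ) (closure (υ ⁻¹' (T₁ \ {(((AlgebraicGeometry.Scheme.IdealSheafData.vanishingIdeal (⟨closure T₁, isClosed_closure⟩ : TopologicalSpace.Closeds F₁))).subschemeι x : F₁)}))) (closure (υ ⁻¹' (E₁ \ {(((AlgebraicGeometry.Scheme.IdealSheafData.vanishingIdeal (⟨closure T₁, isClosed_closure⟩ : TopologicalSpace.Closeds F₁))).subschemeι x : F₁)})))) →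
        -- STAGE-LEVEL HOSTED ROUND at a regular curve `Z` inside the host, unobstructed IN THE HOST (in-host NEST lines and the nose curve alike)
        (∀ (F₁ F₃ : AlgebraicGeometry.Scheme.{0}) (ρ : F₁ ⟶ (Literature.AlgebraicGeometry.Motives.projectiveSpace n k).left) (T₁ E₁ : Set F₁) (Z : Set F₁) (hZ : IsClosed Z) (υ' : F₃ ⟶ F₁),
          Q F₁ ρ T₁ E₁ → Z ⊆ closure E₁ → Z ⊆ T₁ → ¬ T₁ ⊆ Z → (∀ z : ↥(redSub F₁ Z hZ), IsRegularLocalRing ((redSub F₁ Z hZ).presheaf.stalk z)) →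
          (∀ (i : redSub F₁ Z hZ ⟶ redSub F₁ (closure E₁) isClosed_closure), i ≫ redSubι F₁ (closure E₁) isClosed_closure = redSubι F₁ Z hZ →
            ∀ z : ↥(redSub F₁ Z hZ), IsRegularLocalRing ((redSub F₁ (closure E₁) isClosed_closure).presheaf.stalk (i z))) → DirStepUnobs F₁ (closure E₁) isClosed_closure Z hZ →
          (∀ z : ↥(redSub F₁ Z hZ), IsClosed ({z} : Set ↥(redSub F₁ Z hZ)) → ringKrullDim ((redSub F₁ Z hZ).presheaf.stalk z) = ((1 : ℕ) : WithBot ℕ∞)) →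
          Literature.AlgebraicGeometry.Resolution.IsBlowup υ' (AlgebraicGeometry.Scheme.IdealSheafData.vanishingIdeal (⟨Z, hZ⟩ : TopologicalSpace.Closeds F₁)) →
          Q F₃ (υ' ≫ ρ) (closure (υ' ⁻¹' (T₁ \ Z))) (closure (υ' ⁻¹' (closure E₁ \ Z)))) →
        (∀ (F₁ : AlgebraicGeometry.Scheme.{0}) (ρ : F₁ ⟶ (Literature.AlgebraicGeometry.Motives.projectiveSpace n k).left) (T₁ E₁ : Set F₁) (F₉ : AlgebraicGeometry.Scheme.{0}) (β : F₉ ⟶ F₁) (T₉ E₉ : Set F₉),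
          Q F₁ ρ T₁ E₁ → ReachHostedNoseBTriplePrime F₁ T₁ E₁ F₉ β T₉ E₉ → Q F₉ (β ≫ ρ) T₉ E₉) →
        -- INITIAL-STAGE NOSE, host named as the hyperplane `E₀ = V₊(ℓ)`: door ν4 «EQUINODAL» OR door ν3ᵈ «DIRECT PLANAR» (both inside the host) OR door ν3ᶜⁱ
        -- «ci-DIRECT» (`ReachDirectCINose₂`: host-free — `ℓ` is a dummy —, the nose round at the reduced ci curve `Z = V₊(f₁,f₂)` itself, upstairs centre = an explicit
        -- ci SMOOTHING, then a B‴ tail); unavailable when `E₀ = ∅`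
        (∀ (ℓ : MvPolynomial (Fin (n + 1)) k) (F₉ : AlgebraicGeometry.Scheme.{0}) (β : F₉ ⟶ (Literature.AlgebraicGeometry.Motives.projectiveSpace n k).left) (T₉ E₉ : Set F₉),
          Q (Literature.AlgebraicGeometry.Motives.projectiveSpace n k).left (𝟙 (Literature.AlgebraicGeometry.Motives.projectiveSpace n k).left) (Set.range ι) E₀ →
          E₀ = {y : (Literature.AlgebraicGeometry.Motives.projectiveSpace n k).left |
            ℓ ∈ (y : ProjectiveSpectrum (MvPolynomial.homogeneousSubmodule (Fin (n + 1)) k)).asHomogeneousIdeal} →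
          ((ReachEquinodalPlanarNose₂ k n ℓ (Set.range ι) F₉ β T₉ E₉ ∨ ReachDirectPlanarNoseSigma₂ k n ℓ (Set.range ι) F₉ β T₉ E₉) ∨
              ReachDirectCINoseSigma₂ k n (Set.range ι) F₉ β T₉ E₉) →
            Q F₉ β T₉ E₉) → ∃ E' : Set F', Q F' ρ' T' E') ∧
      Literature.AlgebraicGeometry.Resolution.Scheme.IsRegular (AlgebraicGeometry.Scheme.IdealSheafData.vanishingIdeal (⟨closure T', isClosed_closure⟩ : TopologicalSpace.Closeds F')).subscheme)


/-- old door ν3ᵈ ⇒ Σ-door (the tail motive is asked to be closed under MORE rules). [OURS · pure logic] -/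
theorem reachDirectPlanarNoseSigma₂_of_direct₂ (k : Type) [Field k] (n : ℕ) (ℓ : MvPolynomial (Fin (n + 1)) k)
    (T₁ : Set (Literature.AlgebraicGeometry.Motives.projectiveSpace n k).left) (F₉ : Scheme.{0}) (β : F₉ ⟶ (Literature.AlgebraicGeometry.Motives.projectiveSpace n k).left) (T₉ E₉ : Set F₉)
    (h : ReachDirectPlanarNose₂ k n ℓ T₁ F₉ β T₉ E₉) : ReachDirectPlanarNoseSigma₂ k n ℓ T₁ F₉ β T₉ E₉ := by
  obtain ⟨hE, Z, hZ, h1, h2, h3, h4, h5, h6, h7, h8, h9, h10, h11, F₃, υ', hb, γ', E', Es', Ns', K', hR, hβ⟩ := h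
  exact ⟨hE, Z, hZ, h1, h2, h3, h4, h5, h6, h7, h8, h9, h10, h11, F₃, υ', hb, γ', E', Es', Ns', K',
    fun R h0 hreg hram hround _ => hR R h0 hreg hram hround, hβ⟩

/-- old door ν3ᶜⁱ ⇒ Σ-door. [OURS · pure logic] -/
theorem reachDirectCINoseSigma₂_of_directCI₂ (k : Type) [Field k] (n : ℕ)
    (T₁ : Set (Literature.AlgebraicGeometry.Motives.projectiveSpace n k).left) (F₉ : Scheme.{0}) (β : F₉ ⟶ (Literature.AlgebraicGeometry.Motives.projectiveSpace n k).left) (T₉ E₉ : Set F₉)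
    (h : ReachDirectCINose₂ k n T₁ F₉ β T₉ E₉) : ReachDirectCINoseSigma₂ k n T₁ F₉ β T₉ E₉ := by
  obtain ⟨hE, Z, hZ, h1, h2, h3, h4, h5, h6, F₃, υ', hb, γ', E', Es', Ns', K', hR, hβ⟩ := h
  exact ⟨hE, Z, hZ, h1, h2, h3, h4, h5, h6, F₃, υ', hb, γ', E', Es', Ns', K',
    fun R h0 hreg hram hround _ => hR R h0 hreg hram hround, hβ⟩

/-- the 47th's blob ⇒ the Σ-blob (`Q` is asked to be closed under doors that are IMPLIED by the old ones). [OURS · pure logic] -/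
theorem noseHypHostedNestEquinodalDirectCISigmaBTriplePrime₂_of_directCI₂ (k : Type) [Field k] [IsAlgClosed k] (n : ℕ)
    (H : AlgebraicGeometry.Scheme.{0}) (ι : H ⟶ (Literature.AlgebraicGeometry.Motives.projectiveSpace n k).left)
    (h : NoseHypHostedNestEquinodalDirectCIBTriplePrime₂ k n H ι) : NoseHypHostedNestEquinodalDirectCISigmaBTriplePrime₂ k n H ι := by
  obtain ⟨E₀, hE₀, F', ρ', T', hQ, hreg⟩ := h
  refine ⟨E₀, hE₀, F', ρ', T', fun Q hQ0 hpt hround hreach hci => hQ Q hQ0 hpt hround hreach ?_, hreg⟩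
  intro ℓ F₉ β T₉ E₉ hQ₀ hE hR
  refine hci ℓ F₉ β T₉ E₉ hQ₀ hE ?_
  rcases hR with (hR | hR) | hR
  · exact Or.inl (Or.inl hR)
  · exact Or.inl (Or.inr (reachDirectPlanarNoseSigma₂_of_direct₂ k n ℓ _ F₉ β T₉ E₉ hR))
  · exact Or.inr (reachDirectCINoseSigma₂_of_directCI₂ k n _ F₉ β T₉ E₉ hR)

/-- the 46th's blob ⇒ the Σ-blob. [OURS · pure logic] -/
theorem noseHypHostedNestEquinodalDirectCISigmaBTriplePrime₂_of_equinodalDirect₂ (k : Type) [Field k] [IsAlgClosed k] (n : ℕ)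
    (H : AlgebraicGeometry.Scheme.{0}) (ι : H ⟶ (Literature.AlgebraicGeometry.Motives.projectiveSpace n k).left)
    (h : NoseHypHostedNestEquinodalDirectBTriplePrime₂ k n H ι) : NoseHypHostedNestEquinodalDirectCISigmaBTriplePrime₂ k n H ι :=
  noseHypHostedNestEquinodalDirectCISigmaBTriplePrime₂_of_directCI₂ k n H ι
    (noseHypHostedNestEquinodalDirectCIBTriplePrime₂_of_equinodalDirect₂ k n H ι h)

/-- Contrapositive, as the D12 REPLACE cut would consume it: `¬ (Σ-blob) → ¬ (47th blob)`. [OURS · pure logic] -/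
theorem not_noseHypHostedNestEquinodalDirectCIBTriplePrime₂_of_not_directCISigma₂ (k : Type) [Field k] [IsAlgClosed k] (n : ℕ)
    (H : AlgebraicGeometry.Scheme.{0}) (ι : H ⟶ (Literature.AlgebraicGeometry.Motives.projectiveSpace n k).left)
    (h : ¬ NoseHypHostedNestEquinodalDirectCISigmaBTriplePrime₂ k n H ι) : ¬ NoseHypHostedNestEquinodalDirectCIBTriplePrime₂ k n H ι :=
  fun h' => h (noseHypHostedNestEquinodalDirectCISigmaBTriplePrime₂_of_directCI₂ k n H ι h')

/-- … `¬ (Σ-blob) → ¬ (46th blob)`. [OURS · pure logic] -/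
theorem not_noseHypHostedNestEquinodalDirectBTriplePrime₂_of_not_directCISigma₂ (k : Type) [Field k] [IsAlgClosed k] (n : ℕ)
    (H : AlgebraicGeometry.Scheme.{0}) (ι : H ⟶ (Literature.AlgebraicGeometry.Motives.projectiveSpace n k).left)
    (h : ¬ NoseHypHostedNestEquinodalDirectCISigmaBTriplePrime₂ k n H ι) : ¬ NoseHypHostedNestEquinodalDirectBTriplePrime₂ k n H ι :=
  not_noseHypHostedNestEquinodalDirectBTriplePrime₂_of_not_directCI₂ k n H ι
    (not_noseHypHostedNestEquinodalDirectCIBTriplePrime₂_of_not_directCISigma₂ k n H ι h)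

/-- … `¬ (Σ-blob) → ¬ blob₃ᵉ v2`. [OURS · pure logic] -/
theorem not_noseHypHostedNestEquinodalBTriplePrime₂_of_not_directCISigma₂ (k : Type) [Field k] [IsAlgClosed k] (n : ℕ)
    (H : AlgebraicGeometry.Scheme.{0}) (ι : H ⟶ (Literature.AlgebraicGeometry.Motives.projectiveSpace n k).left)
    (h : ¬ NoseHypHostedNestEquinodalDirectCISigmaBTriplePrime₂ k n H ι) : ¬ NoseHypHostedNestEquinodalBTriplePrime₂ k n H ι :=
  not_noseHypHostedNestEquinodalBTriplePrime₂_of_not_directCI₂ k n H ι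
    (not_noseHypHostedNestEquinodalDirectCIBTriplePrime₂_of_not_directCISigma₂ k n H ι h)

/-- … `¬ (Σ-blob) → ¬ blob₂`. [OURS · pure logic] -/
theorem not_noseHypHostedNestBTriplePrime₂_of_not_directCISigma₂ (k : Type) [Field k] [IsAlgClosed k] (n : ℕ)
    (H : AlgebraicGeometry.Scheme.{0}) (ι : H ⟶ (Literature.AlgebraicGeometry.Motives.projectiveSpace n k).left)
    (h : ¬ NoseHypHostedNestEquinodalDirectCISigmaBTriplePrime₂ k n H ι) : ¬ NoseHypHostedNestBTriplePrime₂ k n H ι :=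
  not_noseHypHostedNestBTriplePrime₂_of_not_directCI₂ k n H ι
    (not_noseHypHostedNestEquinodalDirectCIBTriplePrime₂_of_not_directCISigma₂ k n H ι h)

/-- … `¬ (Σ-blob) → ¬ NoseHypPointsFirstBTriplePrime`. [OURS · pure logic] -/
theorem not_noseHypPointsFirstBTriplePrime_of_not_directCISigma₂ (k : Type) [Field k] [IsAlgClosed k] (n : ℕ)
    (H : AlgebraicGeometry.Scheme.{0}) (ι : H ⟶ (Literature.AlgebraicGeometry.Motives.projectiveSpace n k).left)
    (h : ¬ NoseHypHostedNestEquinodalDirectCISigmaBTriplePrime₂ k n H ι) : ¬ NoseHypPointsFirstBTriplePrime k n H ι :=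
  not_noseHypPointsFirstBTriplePrime_of_not_directCI₂ k n H ι
    (not_noseHypHostedNestEquinodalDirectCIBTriplePrime₂_of_not_directCISigma₂ k n H ι h)

end Summit.ResolutionOfSingularities.ResolutionOfSingularities.Cruxes.EquisingularLiftNat.Sections

end
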